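import Literature.Analysis.FluidPDE.NormalisedPressureLpClass
import Literature.Analysis.FluidPDE.TaoEnergyLocalisationPressure
import Literature.Analysis.FluidPDE.LerayPressureDecayReduction
import HarnessLib

/-!
# The local pressure on a quiet shell: the `L¹` bound of the near-field Riesz pressure on a
# sub-shell where the velocity is bounded, and the far field at any scale
# (Kang–Miura–Tsai 2021 Def. 2.1 / Lemma 3.4 split; Bronzi–Shvydkoy 2015 Lemma 2.1, Step 2)

Analysis/FluidPDE support file (theorems only, everything PROVED; no definitions, no named facts,
no `sorry`) in the story of the local pressure expansion
`p = p̃[1_{B_{2r}(x₀)} v] + p_far + c_{x₀,r}(t)` (`LocalLerayPressureDecomposition.lean`,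
`LocalPressureSliceRepresentation.lean`: Kang–Miura–Tsai, PAA **3** (2021) = arXiv:2006.13145,
Def. 2.1 (iv), p. 7 L52–58: "for every `x₀ ∈ ℝ³` and `r > 0`, there exists `c_{x₀,r} ∈ L^{3/2}(0,T)`
such that `p(x,t) − c_{x₀,r}(t) = −⅓|v(x,t)|² + p.v.∫_{B_{3r}(x₀)} K(x−y) : v(y,t) ⊗ v(y,t) dy
+ ∫_{ℝ³∖B_{3r}(x₀)} (K(x−y) − K(x₀−y)) : v(y,t) ⊗ v(y,t) dy` in `L^{3/2}(B_{2r}(x₀) × (0,T))`,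
where `K(x) = ∇²(1/(4π|x|))`"; IMRN 2021 = arXiv:1812.10509 Lemma 3.4 with `2r` in place of `3r`).

What this file supplies is the **shell estimate for the near field** when the velocity slice is
BOUNDED on an annulus — the situation of a Type-I blow-up profile that is quiet on a shell — in
the form consumed by the terminal-trace route of the Navier–Stokes summit (the `L¹` norm of the
pressure, up to a time constant, on a sub-shell, uniformly in time), together with the far-field
bound at an arbitrary scale.  The analysis is the classical three-region split of the singular
integral seen from a point `y` of the sub-shell `T = {R₁ + θ < |y| < R₂ − θ}`
(Bronzi–Shvydkoy, Indiana Univ. Math. J. **64** (2015), §2, proof of Lemma 2.1, Step 2 and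
estimate (2.4): "`⟨|q|^r⟩^{1/r}_{L,2L} ≲ ⟨|v|²⟩_L + ⟨|v|^{2r}⟩^{1/r}_{L/2,4L} + Σ_k ⟨|v|²⟩_{2^kL,2^{k+1}L}`
… by the Calderón–Zygmund boundedness"; Caffarelli–Kohn–Nirenberg 1982 §2; here with the
annulus `S = {R₁ < |z| < R₂}` where `|w| ≤ K` in place of `{L/2 ≤ |z| < 4L}` and the `L^∞` bound in
place of the `L^{2r}` mean):

* §1 `norm_sub_gt_of_mem_subshell` (the excised balls `|z − y| ≤ ε`, `ε < θ`, stay inside `S`),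
  `abs_kernel_apply_rest_le` (`|K(y−z)((1_{B∖S} w) z)| ≤ |(1_{B∖S}w) z|²/(2πθ³)`),
  `hasPressurePV_annulus_of_near` (**principal values correspond**: if `p.v.∫ K(y−z)(1_B w)(z) dz = Λ`
  at `y ∈ T` then `1_S w` has principal value `Λ − J(y)`, `J(y) = ∫ K(y−z)(1_{B∖S} w)(z) dz`),
  `normalisedPressure_near_eq_annulus_add` (`p̃[1_B w](y) = p̃[1_S w](y) + J(y)` where the
  principal value exists), `enorm_normalisedPressure_near_le` (**pointwise**:
  `‖p̃[1_B w](y)‖ ≤ ‖p̃[1_S w](y)‖ + (2πθ³)⁻¹ ∫_B |w|²` for EVERY `y ∈ T` — at points without a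
  principal value the tree's `normalisedPressure` is the documented junk `0`);
* §2 `eLpNorm_annulus_four_le` (`‖1_S w‖₄ ≤ |S|^{1/4} K`), `lintegral_subshell_annulusPressure_le`
  (**Calderón–Zygmund on the bounded piece**, Stein's `L²` bound of the tree
  `exists_eLpNorm_normalisedPressure_le_sq` and Cauchy–Schwarz on `T ⊆ S`:
  `∫_T |p̃[1_S w]| ≤ C_St K² |S|`), and the **shell law**
  `exists_lintegral_subshell_normalisedPressure_near_le`:
  `∫_T |p̃[1_{B_ϱ} w]| ≤ C_St K² |S| + |T| (2πθ³)⁻¹ ∫_{B_ϱ} |w|²` for every measurable `w` with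
  `|w| ≤ K` a.e. on `S`, `R₂ ≤ ϱ` (universal `C_St`; no other hypothesis on `w`);
* §3 `enorm_localPressureFar_le_of_uloc_scale` — the far field `p_far` of the expansion on the
  inner ball `B_r(x₀)` is bounded by `F(r) · sup_z ∫_{B_r(z)} |w|²` at ANY scale `r > 0` (the tree's
  `JiaSverak2014.exists_enorm_localPressureFar_le_of_uloc` is the case `r ≤ 1/2` with unit balls;
  same proof: `enorm_localPressureFar_le` + `exists_farField_tail_le`).

## Mathlib / tree search

Reused by name: `normalisedPressure`, `HasPressurePV`, `truncatedPressureIntegral`,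
`normalisedPressure_eq`, `normalisedPressure_eq_zero_of_not_exists`, `pressureKernel_zero_right`
(`NormalisedPressure`); `abs_pressureKernel_le` (`TaoEnergyLocalisationPressure`); `exists_eLpNorm_normalisedPressure_le_sq`,
`aestronglyMeasurable_normalisedPressure_of_sq`, `memLp_norm_sq_of_memLp_two_mul`
(`NormalisedPressureLpClass`); `enorm_localPressureFar_le`, `exists_abs_pressureKernel_sub_le`
(`LerayPressureDecayProofs`), `exists_farField_tail_le` (`LerayPressureDecayReduction`),
`localPressureFar` (`LocalLerayPressureDecomposition`).  The dyadic-shell sibling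
`BronziShvydkoy2015.hasPressurePV_indicator` / `normalisedPressure_eq_indicator_add` /
`exists_shell_threeHalves_bound` (`SelfSimilarEulerPressureShellBound.lean`) has the fixed ratios
`L/2, L, 2L, 4L` (bounded piece up to twice the outer radius of the estimate), which do not fit a
sub-shell reaching `2/3` of the way to the outer radius; the present file is its free-ratio,
`L^∞`-annulus version.  Mathlib: `eLpNorm_le_of_ae_bound`, `eLpNorm_indicator_eq_eLpNorm_restrict`,
`memLp_indicator_iff_restrict`, `MemLp.of_bound`, `eLpNorm_le_eLpNorm_mul_rpow_measure_univ`,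
`enorm_integral_le_lintegral_enorm`, `setIntegral_eq_integral_of_forall_compl_eq_zero`.
`lean search 'subshell|quiet.*pressure|annulus.*normalisedPressure'`: nothing of this kind.
No new definitions, no instances, no notation.
-/

noncomputable section

open MeasureTheory Set Filter Topology Metric
open scoped ENNReal NNReal RealInnerProductSpace

namespace Literature.Analysis.FluidPDE

namespace QuietShellPressure

variable {w : EuclideanSpace ℝ (Fin 3) → EuclideanSpace ℝ (Fin 3)} {R₁ R₂ θ ϱ : ℝ}
  {y : EuclideanSpace ℝ (Fin 3)}

/-! ## §1 Splitting the principal value seen from a point of the sub-shell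

Notation of the docstrings: `B = B_ϱ(0)` (near ball, `R₂ ≤ ϱ`), `S = {R₁ < |z| < R₂}` (the
annulus where `w` is bounded), `T = {R₁ + θ < |y| < R₂ − θ}` (the sub-shell, margin `θ > 0`),
`1_B w = 1_S w + 1_{B∖S} w`. -/

/-- The annulus `S = {R₁ < |z| < R₂}` is measurable. [folklore] -/
private theorem measurableSet_annulus (R₁ R₂ : ℝ) :
    MeasurableSet {z : EuclideanSpace ℝ (Fin 3) | R₁ < ‖z‖ ∧ ‖z‖ < R₂} :=
  (isOpen_lt continuous_const continuous_norm).measurableSet.inter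
    (isOpen_lt continuous_norm continuous_const).measurableSet

/-- The annulus lies in the near ball: `S ⊆ B_ϱ(0)` for `R₂ ≤ ϱ`. [folklore] -/
private theorem annulus_subset_ball (h : R₂ ≤ ϱ) :
    {z : EuclideanSpace ℝ (Fin 3) | R₁ < ‖z‖ ∧ ‖z‖ < R₂} ⊆ ball (0 : EuclideanSpace ℝ (Fin 3)) ϱ :=
  fun z hz => by rw [mem_ball_zero_iff]; exact hz.2.trans_le h

/-- The sub-shell lies in the annulus: `T ⊆ S` for `θ ≥ 0`. [folklore] -/
private theorem subshell_subset_annulus (hθ : 0 ≤ θ) :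
    {y : EuclideanSpace ℝ (Fin 3) | R₁ + θ < ‖y‖ ∧ ‖y‖ < R₂ - θ} ⊆
      {z : EuclideanSpace ℝ (Fin 3) | R₁ < ‖z‖ ∧ ‖z‖ < R₂} :=
  fun y hy => ⟨by linarith [hy.1], by linarith [hy.2]⟩

/-- **Separation**: a point `z` outside the annulus `S` is at distance `> θ` from every point `y` of
the sub-shell `T` (`|z| ≤ R₁ ⇒ |y − z| ≥ |y| − |z| > θ`; `|z| ≥ R₂ ⇒ |y − z| ≥ |z| − |y| > θ`).
[cite: BronziShvydkoy2015, §2 proof of Lemma 2.1, Step 2 (the regions `|z| < L/2`, `|z| ≥ 4L` seen from `L < |y| < 2L`)] -/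
theorem norm_sub_gt_of_mem_subshell (hy : R₁ + θ < ‖y‖ ∧ ‖y‖ < R₂ - θ)
    {z : EuclideanSpace ℝ (Fin 3)} (hz : z ∉ {z : EuclideanSpace ℝ (Fin 3) | R₁ < ‖z‖ ∧ ‖z‖ < R₂}) :
    θ < ‖y - z‖ := by
  rw [mem_setOf_eq, not_and_or, not_lt, not_lt] at hz
  rcases hz with hz | hz
  · have h := norm_sub_norm_le y z
    linarith
  · have h : ‖z‖ - ‖y‖ ≤ ‖y - z‖ := by
      rw [← norm_neg (y - z), neg_sub]; exact norm_sub_norm_le z y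
    linarith

/-- The kernel integrand of a truncated field is the truncation of the kernel integrand
(`K(z)(0) = 0`). [folklore] -/
private theorem kernel_apply_indicator (A : Set (EuclideanSpace ℝ (Fin 3))) (y : EuclideanSpace ℝ (Fin 3)) :
    (fun z => pressureKernel (y - z) (A.indicator w z)) =
      A.indicator (fun z => pressureKernel (y - z) (w z)) := by
  funext z
  by_cases hz : z ∈ A
  · rw [indicator_of_mem hz, indicator_of_mem hz]
  · rw [indicator_of_notMem hz, indicator_of_notMem hz, pressureKernel_zero_right]

/-- **The separated piece is pointwise small**: for `y ∈ T` and the rest field `b = 1_{B∖S} w`,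
`|K(y − z)(b z)| ≤ |b z|²/(2πθ³)` for every `z` (`b z ≠ 0 ⇒ z ∉ S ⇒ |y − z| > θ`, and
`|K(ζ)(a)| ≤ |a|²/(2π|ζ|³)`). [cite: BronziShvydkoy2015, §2 proof of Lemma 2.1, Step 2 (bounds for J₁, J₃)] -/
theorem abs_kernel_apply_rest_le (hθ : 0 < θ) (hy : R₁ + θ < ‖y‖ ∧ ‖y‖ < R₂ - θ)
    (z : EuclideanSpace ℝ (Fin 3)) :
    |pressureKernel (y - z)
        ((ball (0 : EuclideanSpace ℝ (Fin 3)) ϱ \ {z | R₁ < ‖z‖ ∧ ‖z‖ < R₂}).indicator w z)| ≤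
      (2 * Real.pi * θ ^ 3)⁻¹ *
        ‖(ball (0 : EuclideanSpace ℝ (Fin 3)) ϱ \ {z | R₁ < ‖z‖ ∧ ‖z‖ < R₂}).indicator w z‖ ^ 2 := by
  by_cases hz : z ∈ ball (0 : EuclideanSpace ℝ (Fin 3)) ϱ \ {z | R₁ < ‖z‖ ∧ ‖z‖ < R₂}
  · rw [indicator_of_mem hz]
    have hsep : θ < ‖y - z‖ := norm_sub_gt_of_mem_subshell hy hz.2
    calc |pressureKernel (y - z) (w z)| ≤ ‖w z‖ ^ 2 / (2 * Real.pi * ‖y - z‖ ^ 3) :=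
          abs_pressureKernel_le _ _
      _ ≤ ‖w z‖ ^ 2 / (2 * Real.pi * θ ^ 3) := by
          gcongr
      _ = (2 * Real.pi * θ ^ 3)⁻¹ * ‖w z‖ ^ 2 := by rw [div_eq_inv_mul]
  · rw [indicator_of_notMem hz, pressureKernel_zero_right, norm_zero, abs_zero]
    positivity


/-- The annulus part of the near field: `1_S w = 1_S (1_B w)` (`S ⊆ B`). [folklore] -/
private theorem indicator_annulus_eq (h : R₂ ≤ ϱ) :
    {z : EuclideanSpace ℝ (Fin 3) | R₁ < ‖z‖ ∧ ‖z‖ < R₂}.indicator w =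
      {z : EuclideanSpace ℝ (Fin 3) | R₁ < ‖z‖ ∧ ‖z‖ < R₂}.indicator
        ((ball (0 : EuclideanSpace ℝ (Fin 3)) ϱ).indicator w) := by
  rw [indicator_indicator, inter_eq_left.2 (annulus_subset_ball h)]

/-- The rest of the near field: `1_{B∖S} w = 1_{Sᶜ} (1_B w)`. [folklore] -/
private theorem indicator_rest_eq :
    (ball (0 : EuclideanSpace ℝ (Fin 3)) ϱ \ {z | R₁ < ‖z‖ ∧ ‖z‖ < R₂}).indicator w =
      {z : EuclideanSpace ℝ (Fin 3) | R₁ < ‖z‖ ∧ ‖z‖ < R₂}ᶜ.indicator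
        ((ball (0 : EuclideanSpace ℝ (Fin 3)) ϱ).indicator w) := by
  rw [indicator_indicator, sdiff_eq_compl_inter]

/-- **Splitting of the truncated singular integral seen from the sub-shell.** For `y ∈ T` and
`0 < ε < θ` the excised ball `|z − y| ≤ ε` does not meet `B ∖ S`, so
`∫_{|z−y|>ε} K(y−z)(1_B w)(z) dz = ∫_{|z−y|>ε} K(y−z)(1_S w)(z) dz + J(y)`,
`J(y) = ∫ K(y−z)(1_{B∖S} w)(z) dz` (an integral of an integrand vanishing on `|z − y| ≤ θ`).
[cite: BronziShvydkoy2015, §2 proof of Lemma 2.1, Step 2 (`J = J₁ + J₂ + J₃`)] -/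
theorem truncatedPressureIntegral_near_eq (hSB : R₂ ≤ ϱ) (hy : R₁ + θ < ‖y‖ ∧ ‖y‖ < R₂ - θ)
    {ε : ℝ} (hεθ : ε < θ)
    (hint : IntegrableOn
      (fun z => pressureKernel (y - z) ((ball (0 : EuclideanSpace ℝ (Fin 3)) ϱ).indicator w z))
      (closedBall y ε)ᶜ volume) :
    truncatedPressureIntegral ((ball (0 : EuclideanSpace ℝ (Fin 3)) ϱ).indicator w) y ε =
      truncatedPressureIntegral ({z : EuclideanSpace ℝ (Fin 3) | R₁ < ‖z‖ ∧ ‖z‖ < R₂}.indicator w) y ε +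
        ∫ z, pressureKernel (y - z)
          ((ball (0 : EuclideanSpace ℝ (Fin 3)) ϱ \ {z | R₁ < ‖z‖ ∧ ‖z‖ < R₂}).indicator w z) := by
  set S : Set (EuclideanSpace ℝ (Fin 3)) := {z | R₁ < ‖z‖ ∧ ‖z‖ < R₂} with hS
  have hSm : MeasurableSet S := measurableSet_annulus R₁ R₂
  set f : EuclideanSpace ℝ (Fin 3) → ℝ :=
    fun z => pressureKernel (y - z) ((ball (0 : EuclideanSpace ℝ (Fin 3)) ϱ).indicator w z) with hf
  have ha : (fun z => pressureKernel (y - z) (S.indicator w z)) = S.indicator f := by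
    rw [indicator_annulus_eq (R₁ := R₁) (w := w) hSB]
    exact kernel_apply_indicator S y
  have hb : (fun z => pressureKernel (y - z)
      ((ball (0 : EuclideanSpace ℝ (Fin 3)) ϱ \ S).indicator w z)) = Sᶜ.indicator f := by
    rw [indicator_rest_eq (R₁ := R₁) (R₂ := R₂) (w := w) (ϱ := ϱ)]
    exact kernel_apply_indicator Sᶜ y
  -- the rest integrand vanishes on the excised ball
  have hJ : ∫ z in (closedBall y ε)ᶜ, Sᶜ.indicator f z = ∫ z, Sᶜ.indicator f z := by
    refine setIntegral_eq_integral_of_forall_compl_eq_zero fun z hz => ?_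
    rw [notMem_compl_iff, mem_closedBall, dist_comm, dist_eq_norm] at hz
    have hzS : z ∉ ball (0 : EuclideanSpace ℝ (Fin 3)) ϱ \ S := fun hzS => by
      have := norm_sub_gt_of_mem_subshell hy hzS.2
      linarith
    have e := congrFun hb z
    simp only at e
    rw [← e, indicator_of_notMem hzS, pressureKernel_zero_right]
  have e1 : truncatedPressureIntegral ((ball (0 : EuclideanSpace ℝ (Fin 3)) ϱ).indicator w) y ε =
      ∫ z in (closedBall y ε)ᶜ, f z := rfl
  have e2 : truncatedPressureIntegral (S.indicator w) y ε = ∫ z in (closedBall y ε)ᶜ, S.indicator f z := by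
    rw [truncatedPressureIntegral, ha]
  have e3 : (∫ z, pressureKernel (y - z) ((ball (0 : EuclideanSpace ℝ (Fin 3)) ϱ \ S).indicator w z)) =
      ∫ z, Sᶜ.indicator f z := by
    rw [hb]
  rw [e1, e2, e3, ← hJ, ← integral_add (hint.indicator hSm) (hint.indicator hSm.compl)]
  refine integral_congr_ae (Eventually.of_forall fun z => ?_)
  exact (indicator_self_add_compl_apply S f z).symm

/-- **Principal values correspond under the splitting**: if the near field `1_B w` has principal
value `Λ` at a point `y` of the sub-shell, then the annulus field `1_S w` has principal value
`Λ − J(y)` there. [cite: BronziShvydkoy2015, §2 proof of Lemma 2.1, Step 2] -/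
theorem hasPressurePV_annulus_of_near (hSB : R₂ ≤ ϱ) (hθ : 0 < θ)
    (hy : R₁ + θ < ‖y‖ ∧ ‖y‖ < R₂ - θ) {Λ : ℝ}
    (hPV : HasPressurePV ((ball (0 : EuclideanSpace ℝ (Fin 3)) ϱ).indicator w) y Λ) :
    HasPressurePV ({z : EuclideanSpace ℝ (Fin 3) | R₁ < ‖z‖ ∧ ‖z‖ < R₂}.indicator w) y
      (Λ - ∫ z, pressureKernel (y - z)
        ((ball (0 : EuclideanSpace ℝ (Fin 3)) ϱ \ {z | R₁ < ‖z‖ ∧ ‖z‖ < R₂}).indicator w z)) := by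
  set S : Set (EuclideanSpace ℝ (Fin 3)) := {z | R₁ < ‖z‖ ∧ ‖z‖ < R₂} with hS
  have hSm : MeasurableSet S := measurableSet_annulus R₁ R₂
  have hsmall : ∀ᶠ ε in 𝓝[>] (0 : ℝ), ε < θ := nhdsWithin_le_nhds (Iio_mem_nhds hθ)
  refine ⟨?_, ?_⟩
  · filter_upwards [hPV.1] with ε hε
    rw [indicator_annulus_eq (R₁ := R₁) (w := w) hSB, kernel_apply_indicator S y]
    exact hε.indicator hSm
  · have hev : ∀ᶠ ε in 𝓝[>] (0 : ℝ),
        truncatedPressureIntegral ((ball (0 : EuclideanSpace ℝ (Fin 3)) ϱ).indicator w) y ε -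
          (∫ z, pressureKernel (y - z)
            ((ball (0 : EuclideanSpace ℝ (Fin 3)) ϱ \ S).indicator w z)) =
        truncatedPressureIntegral (S.indicator w) y ε := by
      filter_upwards [hPV.1, hsmall] with ε hint hε
      rw [truncatedPressureIntegral_near_eq hSB hy hε hint]
      ring
    exact (hPV.2.sub_const _).congr' hev

/-- **The near-field pressure splits on the sub-shell**: at a point `y ∈ T` where the principal
value of the near field exists, `p̃[1_B w](y) = p̃[1_S w](y) + J(y)` (on `T ⊆ S ⊆ B` the local
terms `−|·(y)|²/3` of the two normalised pressures agree).
[cite: BronziShvydkoy2015, §2 proof of Lemma 2.1, Step 2] -/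
theorem normalisedPressure_near_eq_annulus_add (hSB : R₂ ≤ ϱ) (hθ : 0 < θ)
    (hy : R₁ + θ < ‖y‖ ∧ ‖y‖ < R₂ - θ)
    (hPV : ∃ Λ, HasPressurePV ((ball (0 : EuclideanSpace ℝ (Fin 3)) ϱ).indicator w) y Λ) :
    normalisedPressure ((ball (0 : EuclideanSpace ℝ (Fin 3)) ϱ).indicator w) y =
      normalisedPressure ({z : EuclideanSpace ℝ (Fin 3) | R₁ < ‖z‖ ∧ ‖z‖ < R₂}.indicator w) y +
        ∫ z, pressureKernel (y - z)
          ((ball (0 : EuclideanSpace ℝ (Fin 3)) ϱ \ {z | R₁ < ‖z‖ ∧ ‖z‖ < R₂}).indicator w z) := by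
  obtain ⟨Λ, hΛ⟩ := hPV
  have hyS : y ∈ {z : EuclideanSpace ℝ (Fin 3) | R₁ < ‖z‖ ∧ ‖z‖ < R₂} :=
    subshell_subset_annulus hθ.le hy
  have hyB : y ∈ ball (0 : EuclideanSpace ℝ (Fin 3)) ϱ := annulus_subset_ball hSB hyS
  rw [normalisedPressure_eq hΛ, normalisedPressure_eq (hasPressurePV_annulus_of_near hSB hθ hy hΛ),
    indicator_of_mem hyS, indicator_of_mem hyB]
  ring

/-- **Pointwise bound on the sub-shell, at every point.** For `y ∈ T`:
`‖p̃[1_B w](y)‖ₑ ≤ ‖p̃[1_S w](y)‖ₑ + (2πθ³)⁻¹ ∫_B ‖w‖ₑ²` — where the principal value exists this is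
the splitting and the bound `|J(y)| ≤ (2πθ³)⁻¹ ∫ |1_{B∖S} w|²`; elsewhere `p̃[1_B w](y)` is the junk
value `0`. [cite: BronziShvydkoy2015, §2 proof of Lemma 2.1, Step 2 (pointwise bounds for J₁, J₃)] -/
theorem enorm_normalisedPressure_near_le (hSB : R₂ ≤ ϱ) (hθ : 0 < θ) (hy : R₁ + θ < ‖y‖ ∧ ‖y‖ < R₂ - θ) :
    ‖normalisedPressure ((ball (0 : EuclideanSpace ℝ (Fin 3)) ϱ).indicator w) y‖ₑ ≤
      ‖normalisedPressure ({z : EuclideanSpace ℝ (Fin 3) | R₁ < ‖z‖ ∧ ‖z‖ < R₂}.indicator w) y‖ₑ +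
        ENNReal.ofReal ((2 * Real.pi * θ ^ 3)⁻¹) *
          ∫⁻ z in ball (0 : EuclideanSpace ℝ (Fin 3)) ϱ, ‖w z‖ₑ ^ 2 := by
  set S : Set (EuclideanSpace ℝ (Fin 3)) := {z | R₁ < ‖z‖ ∧ ‖z‖ < R₂} with hS
  have hSm : MeasurableSet S := measurableSet_annulus R₁ R₂
  set b : EuclideanSpace ℝ (Fin 3) → EuclideanSpace ℝ (Fin 3) :=
    (ball (0 : EuclideanSpace ℝ (Fin 3)) ϱ \ S).indicator w with hb
  -- the bound for `J(y)`
  have hJ : ‖∫ z, pressureKernel (y - z) (b z)‖ₑ ≤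
      ENNReal.ofReal ((2 * Real.pi * θ ^ 3)⁻¹) *
        ∫⁻ z in ball (0 : EuclideanSpace ℝ (Fin 3)) ϱ, ‖w z‖ₑ ^ 2 := by
    refine (enorm_integral_le_lintegral_enorm _).trans ?_
    calc ∫⁻ z, ‖pressureKernel (y - z) (b z)‖ₑ
        ≤ ∫⁻ z, ENNReal.ofReal ((2 * Real.pi * θ ^ 3)⁻¹) * ‖b z‖ₑ ^ 2 := by
          refine lintegral_mono fun z => ?_
          have h := abs_kernel_apply_rest_le (w := w) (ϱ := ϱ) hθ hy z
          rw [Real.enorm_eq_ofReal_abs, ← ofReal_norm, ← ENNReal.ofReal_pow (norm_nonneg _),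
            ← ENNReal.ofReal_mul (by positivity)]
          exact ENNReal.ofReal_le_ofReal h
      _ = ENNReal.ofReal ((2 * Real.pi * θ ^ 3)⁻¹) * ∫⁻ z, ‖b z‖ₑ ^ 2 := by
          rw [lintegral_const_mul' _ _ ENNReal.ofReal_ne_top]
      _ ≤ ENNReal.ofReal ((2 * Real.pi * θ ^ 3)⁻¹) *
            ∫⁻ z in ball (0 : EuclideanSpace ℝ (Fin 3)) ϱ, ‖w z‖ₑ ^ 2 := by
          refine mul_le_mul' le_rfl ?_
          have e : (fun z => ‖b z‖ₑ ^ 2) =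
              (ball (0 : EuclideanSpace ℝ (Fin 3)) ϱ \ S).indicator (fun z => ‖w z‖ₑ ^ 2) := by
            funext z
            by_cases hz : z ∈ ball (0 : EuclideanSpace ℝ (Fin 3)) ϱ \ S
            · rw [hb, indicator_of_mem hz, indicator_of_mem hz]
            · rw [hb, indicator_of_notMem hz, indicator_of_notMem hz, enorm_zero, zero_pow two_ne_zero]
          rw [e, lintegral_indicator (measurableSet_ball.diff hSm)]
          exact lintegral_mono_set fun z hz => hz.1
  by_cases hPV : ∃ Λ, HasPressurePV ((ball (0 : EuclideanSpace ℝ (Fin 3)) ϱ).indicator w) y Λ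
  · rw [normalisedPressure_near_eq_annulus_add hSB hθ hy hPV]
    exact (enorm_add_le _ _).trans (add_le_add le_rfl hJ)
  · rw [normalisedPressure_eq_zero_of_not_exists hPV, enorm_zero]
    exact zero_le

/-! ## §2 Calderón–Zygmund on the annulus piece, and the shell law

The annulus field `1_S w` is bounded by `K` and supported in `S`, so it lies in every `Lᵖ`;
Stein's bound for the quadratic Riesz operator `w ↦ p̃[w]` at `p = 2` (the tree's
`exists_eLpNorm_normalisedPressure_le_sq`: `‖p̃[v]‖₂ ≤ C_St ‖v‖₄²`) and Cauchy–Schwarz on the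
sub-shell `T ⊆ S` give `∫_T |p̃[1_S w]| ≤ |T|^{1/2} C_St |S|^{1/2} K² ≤ C_St K² |S|`. -/

/-- The annulus has finite volume. [folklore] -/
private theorem volume_annulus_lt_top (R₁ R₂ : ℝ) :
    volume {z : EuclideanSpace ℝ (Fin 3) | R₁ < ‖z‖ ∧ ‖z‖ < R₂} < ⊤ :=
  (measure_mono (annulus_subset_ball le_rfl)).trans_lt measure_ball_lt_top

/-- **The annulus field is in `L⁴` with `‖1_S w‖₄ ≤ |S|^{1/4} K`** when `|w| ≤ K` a.e. on `S`.
[folklore] -/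
private theorem memLp_annulus_four (hw : AEStronglyMeasurable w volume) {K : ℝ}
    (hK : ∀ᵐ z ∂volume, R₁ < ‖z‖ → ‖z‖ < R₂ → ‖w z‖ ≤ K) :
    MemLp ({z : EuclideanSpace ℝ (Fin 3) | R₁ < ‖z‖ ∧ ‖z‖ < R₂}.indicator w) 4 volume ∧
      eLpNorm ({z : EuclideanSpace ℝ (Fin 3) | R₁ < ‖z‖ ∧ ‖z‖ < R₂}.indicator w) 4 volume ≤
        volume {z : EuclideanSpace ℝ (Fin 3) | R₁ < ‖z‖ ∧ ‖z‖ < R₂} ^ (1 / 4 : ℝ) * ENNReal.ofReal K := by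
  set S : Set (EuclideanSpace ℝ (Fin 3)) := {z | R₁ < ‖z‖ ∧ ‖z‖ < R₂} with hS
  have hSm : MeasurableSet S := measurableSet_annulus R₁ R₂
  haveI : IsFiniteMeasure (volume.restrict S) :=
    isFiniteMeasure_restrict.2 (volume_annulus_lt_top R₁ R₂).ne
  have hbound : ∀ᵐ z ∂(volume.restrict S), ‖w z‖ ≤ K := by
    rw [ae_restrict_iff' hSm]
    filter_upwards [hK] with z hz hzS
    exact hz hzS.1 hzS.2
  refine ⟨(memLp_indicator_iff_restrict hSm).2 (MemLp.of_bound hw.restrict K hbound), ?_⟩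
  rw [eLpNorm_indicator_eq_eLpNorm_restrict hSm]
  have h := eLpNorm_le_of_ae_bound (p := (4 : ℝ≥0∞)) hbound
  rw [Measure.restrict_apply_univ] at h
  have e : (4 : ℝ≥0∞).toReal⁻¹ = (1 / 4 : ℝ) := by norm_num
  rwa [e] at h

/-- **Calderón–Zygmund on the bounded piece.** With `C` a constant of Stein's `L⁴ × L⁴ → L²`
bound for `v ↦ p̃[v]`, for `|w| ≤ K` a.e. on `S` and `θ ≥ 0`:
`∫_T ‖p̃[1_S w]‖ ≤ C K² |S|`. [cite: BronziShvydkoy2015, §2 proof of Lemma 2.1, Step 2 ("by the Calderón–Zygmund boundedness")] [cite: Stein1971, Ch. II §4.2 Thm 3] -/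
theorem lintegral_subshell_annulusPressure_le {C : ℝ≥0}
    (hC : ∀ v : EuclideanSpace ℝ (Fin 3) → EuclideanSpace ℝ (Fin 3), MemLp v (2 * 2) volume →
      eLpNorm (normalisedPressure v) 2 volume ≤ C * eLpNorm v (2 * 2) volume ^ 2)
    (hw : AEStronglyMeasurable w volume) (hθ : 0 ≤ θ) {K : ℝ}
    (hK : ∀ᵐ z ∂volume, R₁ < ‖z‖ → ‖z‖ < R₂ → ‖w z‖ ≤ K) :
    ∫⁻ y in {y : EuclideanSpace ℝ (Fin 3) | R₁ + θ < ‖y‖ ∧ ‖y‖ < R₂ - θ},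
        ‖normalisedPressure ({z : EuclideanSpace ℝ (Fin 3) | R₁ < ‖z‖ ∧ ‖z‖ < R₂}.indicator w) y‖ₑ ≤
      C * ENNReal.ofReal K ^ 2 * volume {z : EuclideanSpace ℝ (Fin 3) | R₁ < ‖z‖ ∧ ‖z‖ < R₂} := by
  set S : Set (EuclideanSpace ℝ (Fin 3)) := {z | R₁ < ‖z‖ ∧ ‖z‖ < R₂} with hS
  set T : Set (EuclideanSpace ℝ (Fin 3)) := {y | R₁ + θ < ‖y‖ ∧ ‖y‖ < R₂ - θ} with hT
  have hSm : MeasurableSet S := measurableSet_annulus R₁ R₂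
  set a : EuclideanSpace ℝ (Fin 3) → EuclideanSpace ℝ (Fin 3) := S.indicator w with ha
  have h44 : (2 : ℝ≥0∞) * 2 = 4 := by norm_num
  obtain ⟨ha4, ha4le⟩ := memLp_annulus_four (R₁ := R₁) (R₂ := R₂) hw hK
  rw [← h44] at ha4
  have haC := hC a ha4
  have ham : AEStronglyMeasurable a volume := hw.indicator hSm
  have hpm : AEStronglyMeasurable (normalisedPressure a) volume :=
    aestronglyMeasurable_normalisedPressure_of_sq (p := 2) ENNReal.one_lt_two ENNReal.ofNat_lt_top ham
      (memLp_norm_sq_of_memLp_two_mul ha4)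
  rw [h44] at haC
  -- Cauchy–Schwarz on `T`
  have hCS : ∫⁻ y in T, ‖normalisedPressure a y‖ₑ ≤
      eLpNorm (normalisedPressure a) 2 (volume.restrict T) * volume T ^ (1 / 2 : ℝ) := by
    have h := eLpNorm_le_eLpNorm_mul_rpow_measure_univ (p := 1) (q := 2) (μ := volume.restrict T)
      one_le_two hpm.restrict
    rw [eLpNorm_one_eq_lintegral_enorm, Measure.restrict_apply_univ] at h
    have e : 1 / (1 : ℝ≥0∞).toReal - 1 / (2 : ℝ≥0∞).toReal = (1 / 2 : ℝ) := by norm_num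
    rwa [e] at h
  have hpow : (volume S ^ (1 / 4 : ℝ) * ENNReal.ofReal K) ^ 2 * volume S ^ (1 / 2 : ℝ) =
      ENNReal.ofReal K ^ 2 * volume S := by
    rw [mul_pow, ← ENNReal.rpow_two (volume S ^ (1 / 4 : ℝ)), ← ENNReal.rpow_mul]
    have e : (1 / 4 : ℝ) * 2 = 1 / 2 := by norm_num
    rw [e, mul_comm (volume S ^ (1 / 2 : ℝ)) _, mul_assoc,
      ← ENNReal.rpow_add_of_nonneg _ _ (by norm_num : (0 : ℝ) ≤ 1 / 2) (by norm_num : (0 : ℝ) ≤ 1 / 2)]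
    norm_num
  calc ∫⁻ y in T, ‖normalisedPressure a y‖ₑ
      ≤ eLpNorm (normalisedPressure a) 2 (volume.restrict T) * volume T ^ (1 / 2 : ℝ) := hCS
    _ ≤ eLpNorm (normalisedPressure a) 2 volume * volume S ^ (1 / 2 : ℝ) :=
        mul_le_mul' (eLpNorm_restrict_le _ _ _ _)
          (ENNReal.rpow_le_rpow (measure_mono (subshell_subset_annulus hθ)) (by norm_num))
    _ ≤ C * eLpNorm a 4 volume ^ 2 * volume S ^ (1 / 2 : ℝ) := mul_le_mul' haC le_rfl
    _ ≤ C * (volume S ^ (1 / 4 : ℝ) * ENNReal.ofReal K) ^ 2 * volume S ^ (1 / 2 : ℝ) := by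
        gcongr
    _ = C * ENNReal.ofReal K ^ 2 * volume S := by
        rw [mul_assoc, mul_assoc, hpow, ← mul_assoc]

/-- **The shell law for the near-field pressure (`L¹` on the sub-shell).** There is a universal
`C ≥ 0` such that for every a.e.-strongly measurable `w : ℝ³ → ℝ³`, radii `R₁, R₂ ≤ ϱ`, margin
`θ > 0` and bound `K` with `|w| ≤ K` a.e. on the annulus `S = {R₁ < |z| < R₂}`:
`∫_{R₁+θ<|y|<R₂−θ} |p̃[1_{B_ϱ(0)} w](y)| dy ≤ C K² |S| + (2πθ³)⁻¹ (∫_{B_ϱ(0)} |w|²) |T|`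
(annulus piece by Calderón–Zygmund, separated piece pointwise by the kernel bound
`|K(ζ)(a)| ≤ |a|²/(2π|ζ|³)`; no integrability hypothesis on `w` — where the principal value of
the near field fails to exist the normalised pressure is the junk `0`).
[cite: BronziShvydkoy2015, §2 Lemma 2.1, Step 2 and eq. (2.4) (three-region split of the singular integral, CZ on the middle region)] [cite: KangMiuraTsai2021PAA, Def. 2.1 (iv) p. 7 (the near field `−⅓|v|² + p.v.∫_{B} K(x−y) : v ⊗ v` of the local pressure expansion)] -/
theorem exists_lintegral_subshell_normalisedPressure_near_le :
    ∃ C : ℝ≥0, ∀ (w : EuclideanSpace ℝ (Fin 3) → EuclideanSpace ℝ (Fin 3)) (R₁ R₂ θ ϱ K : ℝ),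
      AEStronglyMeasurable w volume → 0 < θ → R₂ ≤ ϱ →
      (∀ᵐ z ∂volume, R₁ < ‖z‖ → ‖z‖ < R₂ → ‖w z‖ ≤ K) →
      ∫⁻ y in {y : EuclideanSpace ℝ (Fin 3) | R₁ + θ < ‖y‖ ∧ ‖y‖ < R₂ - θ},
          ‖normalisedPressure ((ball (0 : EuclideanSpace ℝ (Fin 3)) ϱ).indicator w) y‖ₑ ≤
        C * ENNReal.ofReal K ^ 2 * volume {z : EuclideanSpace ℝ (Fin 3) | R₁ < ‖z‖ ∧ ‖z‖ < R₂} +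
          ENNReal.ofReal ((2 * Real.pi * θ ^ 3)⁻¹) *
            (∫⁻ z in ball (0 : EuclideanSpace ℝ (Fin 3)) ϱ, ‖w z‖ₑ ^ 2) *
            volume {y : EuclideanSpace ℝ (Fin 3) | R₁ + θ < ‖y‖ ∧ ‖y‖ < R₂ - θ} := by
  obtain ⟨C, hC⟩ := exists_eLpNorm_normalisedPressure_le_sq (p := 2) ENNReal.one_lt_two ENNReal.ofNat_lt_top
  refine ⟨C, fun w R₁ R₂ θ ϱ K hw hθ hSB hK => ?_⟩
  set S : Set (EuclideanSpace ℝ (Fin 3)) := {z | R₁ < ‖z‖ ∧ ‖z‖ < R₂} with hS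
  set T : Set (EuclideanSpace ℝ (Fin 3)) := {y | R₁ + θ < ‖y‖ ∧ ‖y‖ < R₂ - θ} with hT
  have hTm : MeasurableSet T := measurableSet_annulus (R₁ + θ) (R₂ - θ)
  set c : ℝ≥0∞ := ENNReal.ofReal ((2 * Real.pi * θ ^ 3)⁻¹) *
    ∫⁻ z in ball (0 : EuclideanSpace ℝ (Fin 3)) ϱ, ‖w z‖ₑ ^ 2 with hc
  calc ∫⁻ y in T, ‖normalisedPressure ((ball (0 : EuclideanSpace ℝ (Fin 3)) ϱ).indicator w) y‖ₑ
      ≤ ∫⁻ y in T, (‖normalisedPressure (S.indicator w) y‖ₑ + c) :=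
        setLIntegral_mono' hTm fun y hy => enorm_normalisedPressure_near_le hSB hθ hy
    _ = (∫⁻ y in T, ‖normalisedPressure (S.indicator w) y‖ₑ) + c * volume T := by
        rw [lintegral_add_right _ measurable_const, lintegral_const, Measure.restrict_apply_univ]
    _ ≤ C * ENNReal.ofReal K ^ 2 * volume S + c * volume T := by
        gcongr
        exact lintegral_subshell_annulusPressure_le hC hw hθ.le hK

/-! ## §3 The far field of the local pressure expansion at any scale

Kang–Miura–Tsai's `p_far(t,x) = ∫_{|y−x₀| ≥ 2r} (K(x−y) − K(x₀−y)) : (v ⊗ v)(y,t) dy`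
(`localPressureFar x₀ r v t x`) is bounded on the inner ball `B_r(x₀)` by the uniformly local
energy AT SCALE `r`: "`|p_far(x,t)| ≤ ∫_{2R<|y−x₀|} cR|x₀−y|⁻⁴|v(y,t)|² dy ≤ Σ_{0≠k∈ℤ³}
∫_{B_R(x₀+Rk)} cR|Rk|⁻⁴|v|² ≤ c R⁻³ ‖v(t)‖²_{L²_{uloc,R}}`" (IMRN 2021 §8, proof of Lemma 3.4, p. 18).
The tree proves the two halves (`enorm_localPressureFar_le`, `exists_farField_tail_le`, any
`r > 0`) and assembles them only for `r ≤ 1/2` with unit balls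
(`JiaSverak2014.exists_enorm_localPressureFar_le_of_uloc`); here is the assembly at scale `r`. -/

/-- **The far-field pressure on the inner ball is bounded by the uniformly local energy at the
scale of the ball**: for every `r > 0` there is `F = F(r) < ∞` such that for every measurable
slice with `∫_{B(z,r)} |v(t)|² ≤ α` for all centres `z` and every `x ∈ B(x₀, r)`,
`‖localPressureFar x₀ r v t x‖ₑ ≤ F α`.
[cite: KangMiuraTsai2020, §8 proof of Lemma 3.4 (bound for p_far by the uniformly local energy at scale R), arXiv:1812.10509 p. 18] [cite: JiaSverak2014, formula (3.3) p. 7] -/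
theorem exists_enorm_localPressureFar_le_of_uloc_scale {r : ℝ} (hr : 0 < r) :
    ∃ F : ℝ≥0∞, F ≠ ⊤ ∧
      ∀ {v : ℝ → EuclideanSpace ℝ (Fin 3) → EuclideanSpace ℝ (Fin 3)} {t : ℝ}
        {x₀ : EuclideanSpace ℝ (Fin 3)} {α : ℝ≥0∞},
      AEStronglyMeasurable (v t) volume →
      (∀ z : EuclideanSpace ℝ (Fin 3), ∫⁻ y in ball z r, ‖v t y‖ₑ ^ 2 ≤ α) →
      ∀ x ∈ ball x₀ r, ‖localPressureFar x₀ r v t x‖ₑ ≤ F * α := by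
  obtain ⟨CK, hCK0, hCK⟩ := exists_abs_pressureKernel_sub_le
  obtain ⟨Kt, hKtt, hKtail⟩ := exists_farField_tail_le hr
  refine ⟨ENNReal.ofReal (CK * r) * (Kt * ENNReal.ofReal ((2 * r - r)⁻¹)), ?_, ?_⟩
  · exact ENNReal.mul_ne_top ENNReal.ofReal_ne_top (ENNReal.mul_ne_top hKtt ENNReal.ofReal_ne_top)
  intro v t x₀ α hm hα x hx
  have h1 := enorm_localPressureFar_le hCK0 hCK x₀ hr v t hx
  have htail := hKtail (fun y => ‖v t y‖ₑ ^ (2 : ℕ)) (hm.aemeasurable.enorm.pow_const _) α hα x₀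
    (2 * r) le_rfl
  have hker : ∀ y : EuclideanSpace ℝ (Fin 3),
      RieszKernel.powKer 4 (y - x₀) = ENNReal.ofReal ((‖y - x₀‖ ^ 4)⁻¹) := fun y => by
    rw [RieszKernel.powKer_apply, Real.rpow_neg (norm_nonneg _),
      show (4 : ℝ) = ((4 : ℕ) : ℝ) by norm_num, Real.rpow_natCast]
  simp_rw [hker] at h1
  calc ‖localPressureFar x₀ r v t x‖ₑ
      ≤ ENNReal.ofReal (CK * r) *
          ∫⁻ y in (ball x₀ (2 * r))ᶜ, ‖v t y‖ₑ ^ (2 : ℕ) * ENNReal.ofReal ((‖y - x₀‖ ^ 4)⁻¹) := h1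
    _ ≤ ENNReal.ofReal (CK * r) * (Kt * ENNReal.ofReal ((2 * r - r)⁻¹) * α) :=
        mul_le_mul' le_rfl htail
    _ = _ := by ring

/-- **Uniformly local energy at scale `r` from bounds at the points of an `r`-dense set at scale
`2r`** (the covering step used with a Morrey-type bound `∫_{B_ρ(q)} |v|² ≤ m ρ` known only at the
points `q` of a countable set `Q`, e.g. the rational points, on almost every time slice): if every
`z` has some `q ∈ Q` with `|z − q| < r`, then `B_r(z) ⊆ B_{2r}(q)`, so
`sup_z ∫_{B_r(z)} g ≤ sup_{q ∈ Q} ∫_{B_{2r}(q)} g` (the uniformly local norms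
`‖f‖_{L^q_{uloc,ρ}} = sup_x ‖f‖_{L^q(B_ρ(x))}` at comparable radii are comparable).
[cite: KangMiuraTsai2020, §1 (definition of ‖·‖_{L^q_{uloc,ρ}}, arXiv:1812.10509 p. 4) and §8 (the lattice covering in the bound for p_far, p. 18)] -/
theorem forall_lintegral_ball_le_of_dense {Q : Set (EuclideanSpace ℝ (Fin 3))} {r : ℝ}
    (hQ : ∀ z : EuclideanSpace ℝ (Fin 3), ∃ q ∈ Q, dist z q < r)
    {g : EuclideanSpace ℝ (Fin 3) → ℝ≥0∞} {α : ℝ≥0∞}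
    (hα : ∀ q ∈ Q, ∫⁻ y in ball q (2 * r), g y ≤ α) (z : EuclideanSpace ℝ (Fin 3)) :
    ∫⁻ y in ball z r, g y ≤ α := by
  obtain ⟨q, hq, hzq⟩ := hQ z
  refine (lintegral_mono_set fun y hy => ?_).trans (hα q hq)
  rw [mem_ball] at hy ⊢
  calc dist y q ≤ dist y z + dist z q := dist_triangle _ _ _
    _ < r + r := add_lt_add hy hzq
    _ = 2 * r := by ring

end QuietShellPressure

end Literature.Analysis.FluidPDE

end
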